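import Summits.ResolutionOfSingularities.ResolutionOfSingularities.Theorems.EquisingularLiftEquisingularLiftNatUncentredConeGerm
import Summits.ResolutionOfSingularities.ResolutionOfSingularities.Theorems.EquisingularLiftEquisingularLiftNatPrescribedGermDivisor
import Summits.ResolutionOfSingularities.ResolutionOfSingularities.Theorems.EquisingularLiftEquisingularLiftNatCarrierPairStrictTransformRegular
import Summits.ResolutionOfSingularities.ResolutionOfSingularities.Theorems.EquisingularLiftEquisingularLiftNatSubchainSupplierInvDefs
import Summits.ResolutionOfSingularities.ResolutionOfSingularities.Theorems.EquisingularLiftEquisingularLiftChainRegular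
import HarnessLib

/-!
# [OURS · L1 W4.5(b) · EL♮(3)] HSUB(ReachTC⁺)₃ brick `inv_base`, part 1d: THE UNCENTRED MEMBER `TCPlus.Member … F₂ T₂ Z₂ ∅`

Crux chain w45b (cell `res-hironaka`, slot W4.5(b)), working crux **EL♮** = stmt-ResolutionOfSingularities-20038, child **EL♮(3)** =
stmt-ResolutionOfSingularities-20148, route EquisingularLift, line `sections`, registered stub `stub_elnat_tcPlusPointResolution`;
assembly HSUB(ReachTC⁺)₃ of res-L1-w45b-stub-1 (driver `hsub_reachTCPlus_of_invariant` p526242; INV DEFS v3 = …NatSubchainSupplierInvDefs,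
p532383; brick `inv_base` dealt to res-type-100 2026-08-27T11:31:42Z). HONEST FRAMING: OURS; NOT a statement of any manuscript;
AI-written, weaker than expert review. No `sorry`; standard axioms. `--supports stmt-ResolutionOfSingularities-20148 --as helper`.

WHAT. **`tcPlus_member_uncentred`**: in the binders of the driver's point step at relative dimension `3` (a `Ch`-stage `(X', σ', S')`
with `σ' ≫ q` proper, the model square `j : F₁ → X'`, a section `s` through `s(s₀) = j x` with `dim 𝒪_{X',j x} = 3 + 1`, the blow-up
`τ₁ : X₁ → X'` of the section with its model square `j₂ : F₂ → X₁` over the point blow-up `υ : F₂ → F₁` of `x`, `Ch X₁ (τ₁ ≫ σ') (j₂ '' T₂)`)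
and for every admissible hypersurface germ `W ∋ x` (`e ⊄ St W`, locally principal at `x`), the UNCENTRED MEMBER of the invariant holds:
`TCPlus.Member O k θ P q Y Ch F₂ T₂ Z₂ ∅` with `T₂ = closure υ⁻¹(T₁ ∖ {x})`, `Z₂ = υ⁻¹{x} ∩ closure υ⁻¹(W ∖ {x})`. Witnesses: the stage
`X₁` itself, `jG = j₂`, the carrier `𝓢 = (ker s)·𝒪_{X₁}` and the strict transform `K = St_{τ₁} K₀` of the PRESCRIBED-GERM CARTIER DIVISOR
`K₀` (part 1c, p534222) with germ the `O`-cone `Φ₀(c)` of part 1b's `exists_coneGerm_of_admTC` (p533707, `n = 3`: no finiteness input);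
clause (iii) «`K_z` principal for all `z`» by res-D-pv-032's `isPrincipal_stalkIdeal_strictTransformIdeal` (p529806).

References (index only): res-L1-w45b-stub-1 HSUB-TCPLUS3-skeleton.lean / SubchainSupplierInvDefs.lean (OURS planning texts).
-/

set_option linter.dupNamespace false -- mandated namespace `Summit.<Summit>.<Problem>` of this single-conjunct summit
set_option linter.overlappingInstances false -- the binders carry `[IsDomain O] [IsDiscreteValuationRing O]`

noncomputable section

open CategoryTheory CategoryTheory.Limits AlgebraicGeometry TopologicalSpace IsLocalRing
open Literature.AlgebraicGeometry.Resolution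
open AlgebraicGeometry.Scheme.IdealSheafData
open Summit.ResolutionOfSingularities.ResolutionOfSingularities.Cruxes.EquisingularLift.StrataSplit

namespace Summit.ResolutionOfSingularities.ResolutionOfSingularities.Cruxes.EquisingularLiftNat.Sections

/-- The centre of a blow-up with a point over it is not the zero ideal sheaf (its pullback is an effective Cartier divisor, locally
generated by a non-zero-divisor of a non-trivial local ring). [folklore] -/
theorem ne_bot_of_isBlowup {X X' : Scheme.{0}} {τ : X' ⟶ X} {C : X.IdealSheafData} (hτ : IsBlowup τ C) (x' : X') : C ≠ ⊥ := by
  rintro rfl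
  obtain ⟨t, ht, hKt⟩ := hτ.isEffectiveCartier.exists_stalkIdeal_eq_span x'
  rw [Scheme.IdealSheafData.comap_bot, stalkIdeal_bot, eq_comm, Ideal.span_singleton_eq_bot] at hKt
  rw [hKt] at ht
  exact zero_notMem_nonZeroDivisors ht

/-- **THE UNCENTRED MEMBER OF THE INVARIANT** (`TCPlus.Member … F₂ T₂ Z₂ ∅`, res-L1-w45b-stub-1 INV DEFS v3; see the module docstring).
[cite: Matsumura1987, Thm. 14.2; StacksProject, Tag 0804] -/
theorem tcPlus_member_uncentred (k : Type) [Field k] [IsAlgClosed k] (O : Type) [CommRing O] [IsDomain O]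
    [IsDiscreteValuationRing O] [IsAdicComplete (IsLocalRing.maximalIdeal O) O] [IsAlgClosed (IsLocalRing.ResidueField O)]
    (θ : O →+* k) (hθ : Function.Surjective θ) (P : Scheme.{0}) (q : P ⟶ Spec (.of O)) (Y : Set P)
    (Ch : ∀ X' : Scheme.{0}, (X' ⟶ P) → Set X' → Prop)
    (hChSplit : ∀ (X' : Scheme.{0}) (σ' : X' ⟶ P) (S' : Set X'), Ch X' σ' S' →
      Summit.ResolutionOfSingularities.ResolutionOfSingularities.Theses.EquisingularLift.Split.Chain P Y X' σ' S')
    (hPnoeth : IsLocallyNoetherian P) (hPreg : Scheme.IsRegular P) [IsProper q]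
    (X' : Scheme.{0}) (σ' : X' ⟶ P) (S' : Set X') (hCh' : Ch X' σ' S') [IsIntegral X'] [IsLocallyNoetherian X']
    (hX'reg : Scheme.IsRegular X') (F₁ : Scheme.{0}) [IsIntegral F₁] (j : F₁ ⟶ X') (t : F₁ ⟶ Spec (.of k))
    (hsq : IsPullback j t (σ' ≫ q) (Spec.map (CommRingCat.ofHom θ))) (T₁ : Set F₁) (x : F₁) (hx : IsClosed ({x} : Set F₁))
    (U : X'.Opens) (hU : Smooth (U.ι ≫ σ' ≫ q)) (s : Spec (.of O) ⟶ X') (hs : s ≫ σ' ≫ q = 𝟙 _)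
    (hsU : s (IsLocalRing.closedPoint O) ∈ U) (hsx : s (IsLocalRing.closedPoint O) = j x)
    (hdim : ringKrullDim (X'.presheaf.stalk (s (IsLocalRing.closedPoint O))) = ((3 + 1 : ℕ) : WithBot ℕ∞))
    (hsoff : ∀ c ∈ (s.ker.support : Set X'), ¬ IsGenericPoint (σ' c) Y)
    (X₁ : Scheme.{0}) (τ₁ : X₁ ⟶ X') (hτ₁ : IsBlowup τ₁ s.ker) [IsIntegral X₁] [IsLocallyNoetherian X₁]
    (hX₁reg : Scheme.IsRegular X₁) (hX₁dom : IsDominant ((τ₁ ≫ σ') ≫ q))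
    (F₂ : Scheme.{0}) [IsIntegral F₂] (υ : F₂ ⟶ F₁) (hυ : IsBlowup υ (vanishingIdeal (⟨{x}, hx⟩ : Closeds F₁)))
    (j₂ : F₂ ⟶ X₁) (t₂ : F₂ ⟶ Spec (.of k)) (hsq₂ : IsPullback j₂ t₂ ((τ₁ ≫ σ') ≫ q) (Spec.map (CommRingCat.ofHom θ)))
    (hcomm : j₂ ≫ τ₁ = υ ≫ j) (hcarrier : (s.ker.comap τ₁).comap j₂ = (vanishingIdeal (⟨{x}, hx⟩ : Closeds F₁)).comap υ)
    (hCh₁ : Ch X₁ (τ₁ ≫ σ') (j₂ '' closure (υ ⁻¹' (T₁ \ {x}))))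
    (W : Set F₁) (hxW : x ∈ W) (hnot : ¬ (υ ⁻¹' {x} ⊆ closure (υ ⁻¹' (W \ {x}))))
    (hWpr : ∃ U₁ : F₁.affineOpens, x ∈ (U₁ : F₁.Opens) ∧
      ((vanishingIdeal (⟨closure W, isClosed_closure⟩ : Closeds F₁)).ideal U₁).IsPrincipal) :
    TCPlus.Member O k θ P q Y Ch F₂ (closure (υ ⁻¹' (T₁ \ {x}))) (υ ⁻¹' {x} ∩ closure (υ ⁻¹' (W \ {x}))) ∅ := by
  -- properness of the stage (a chain of blow-ups in regular centres is proper)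
  haveI : IsProper σ' := (chain_isRegular P Y X' σ' S' (hChSplit X' σ' S' hCh') hPnoeth hPreg).2.2
  haveI : IsProper (σ' ≫ q) := inferInstance
  have hZ : IsClosed (υ ⁻¹' {x} ∩ closure (υ ⁻¹' (W \ {x}))) := (hx.preimage υ.continuous).inter isClosed_closure
  have hsq₂' : IsPullback j₂ t₂ (τ₁ ≫ σ' ≫ q) (Spec.map (CommRingCat.ofHom θ)) := by
    simpa only [Category.assoc] using hsq₂
  -- part 1b: the carrier and the cone germ (`n = 3`: the plane lift, no finiteness input)
  obtain ⟨hEreg, hEpr, f, hf0, hK⟩ := exists_coneGerm_of_admTC k 3 O θ hθ X' (σ' ≫ q) hX'reg inferInstance U hU s hs hsU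
    hdim X₁ τ₁ hτ₁ F₁ j t hsq x hx hsx F₂ υ hυ j₂ t₂ hsq₂' hcomm hcarrier W hZ hxW hnot hWpr (Or.inl rfl)
  -- part 1c: the prescribed-germ Cartier divisor with germ `f`, and the clauses for its strict transform
  obtain ⟨K₀, hK₀pr, hK₀⟩ := exists_forall_isPrincipal_stalkIdeal_eq_span hX'reg (j x) hf0
  obtain ⟨hi, hii, -, hiv, hv, hcodim, -⟩ := hK K₀ hK₀
  -- the section centre is regular and non-zero
  obtain ⟨-, hsreg, -, hsupp⟩ := section_isClosedImmersion_and_isRegular_ker O X' (σ' ≫ q) s hs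
  obtain ⟨y₁⟩ := (inferInstance : Nonempty F₂)
  have hs0 : s.ker ≠ ⊥ := ne_bot_of_isBlowup hτ₁ (j₂ y₁)
  refine ⟨X₁, τ₁ ≫ σ', _, j₂, t₂, s.ker.comap τ₁, strictTransformIdeal τ₁ s.ker K₀, hCh₁, ‹_›, ‹_›, hX₁reg, hX₁dom, hsq₂,
    rfl, ?_, ?_, hEreg, fun z => ⟨hEpr z, ?_⟩, ?_, fun z hz hzq _ => ⟨hv z hz, fun _ => hcodim z hz ?_⟩, ?_⟩
  · -- (i) exact special fibre
    have hcl : (⟨closure (υ ⁻¹' {x} ∩ closure (υ ⁻¹' (W \ {x}))), isClosed_closure⟩ : Closeds F₂) =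
        ⟨υ ⁻¹' {x} ∩ closure (υ ⁻¹' (W \ {x})), hZ⟩ := Closeds.ext hZ.closure_eq
    rw [hcl]; exact hi
  · -- (ii) flat over `O`
    simpa only [Category.assoc] using hii
  · -- (iii) the cone is principal at every point (res-D-pv-032, p529806)
    exact isPrincipal_stalkIdeal_strictTransformIdeal hX'reg hsreg hτ₁ hs0 K₀ hK₀pr z
  · -- (iv) off the generic points of `Y`
    rintro _ ⟨z, hz, rfl⟩
    have hzE : τ₁ z ∈ (s.ker.support : Set X') := by
      have h := hiv hz
      rw [SetLike.mem_coe, Scheme.IdealSheafData.support_comap] at h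
      exact h
    rw [Scheme.Hom.comp_apply]
    exact hsoff _ hzE
  · -- (v) the special points lie over the closed point
    simpa only [Category.assoc] using hzq
  · -- (vi) no excluded point
    intro y₀ hy₀
    exact absurd hy₀ (Set.notMem_empty _)

end Summit.ResolutionOfSingularities.ResolutionOfSingularities.Cruxes.EquisingularLiftNat.Sections

end
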